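import Summits.AtomisticToContinuum.FouriersLaw.Theorems.UnboundedHeatVariance.Negative.AbstractCage

/-!
# `CageBudgetFekete.UnboundedHeatVariance` / Negative (3): the picked line `birth` smuggles no gap —
# its open stub S2 is NECESSARY for the crux

Support file (`--supports stmt-AtomisticToContinuum-15771`) of the crux disprover. The lead picked line
`birth` (`Cruxes/UnboundedHeatVariance/Lines/birth.lean`, 2026-08-17): `stub_currentSpectralMeasure` (S1,
Bochner representation, provable) → `stub_infraredCurrentSpectrum` (S2, open) →
`stub_spectralHeatVarianceUnbounded` (S3, Cesàro–Fatou, provable) → `UnboundedHeatVariance` (kernel-checked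
composition). Joint-sufficiency audit, negative side: could S2 OVERSHOOT the crux (be false while U is true)?
No —

* `stub_infraredCurrentSpectrum_of_unboundedHeatVariance` — **U ⟹ S2 verbatim** (the statement of S2 is
  spelled inline, byte-identical to the registered stub): if some finite `ρ` representing `C` on `t ≥ 0` had no
  atom at `0` and `ρ`-integrable `ω ↦ (ω²)⁻¹`, the abstract insulator criterion
  (`spectralHeatVariance_le_of_integrable_inv_sq`, Negative (2)) would cage `V ≤ 4∫(ω²)⁻¹dρ`, contradicting U
  at `R = 4∫(ω²)⁻¹dρ`.

Consequently S2 ⟺ U modulo the two provable stubs S1, S3: the line is an exact reformulation (no strength is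
lost or smuggled by attacking S2), and — read negatively — a disproof of U is the same thing as ONE guarded
`(μ, D)` with ONE finite representing measure of insulating type. No new definitions.
refuter-cdisprove-stmt-AtomisticToContinuum-15771-0, 2026-08-17.
-/

noncomputable section

namespace Summit.AtomisticToContinuum.FouriersLaw.Theorems.UnboundedHeatVariance.Negative

open MeasureTheory Set Filter Topology
open Literature.MathematicalPhysics.KineticTheory.HeatConduction
open Summit.AtomisticToContinuum.FouriersLaw.Theses

/-- **The crux implies the line's open stub S2** (`birth`, `stub_infraredCurrentSpectrum`, statement verbatim):
in the guarded arena, unboundedness of the heat variance forces every finite measure `ρ` representing the summed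
current autocorrelation on `t ≥ 0` to charge the infrared, `0 < ρ{0} ∨ ¬Integrable (ω ↦ (ω²)⁻¹) ρ` — by the
abstract insulator criterion `spectralHeatVariance_le_of_integrable_inv_sq`. [folklore] -/
theorem stub_infraredCurrentSpectrum_of_unboundedHeatVariance (hU : CageBudgetFekete.UnboundedHeatVariance) :
    ∀ ω₂ lam β γ : ℝ, 0 < ω₂ → 0 < lam → 0 < β → ∀ T : ℝ, 0 < T → ∀ μ : MeasureTheory.Measure Literature.MathematicalPhysics.KineticTheory.HeatConduction.ChainConfig, (Literature.MathematicalPhysics.KineticTheory.HeatConduction.pinnedChain ω₂ lam β γ).IsChainGibbsMeasure T μ → Literature.MathematicalPhysics.KineticTheory.HeatConduction.IsShiftInvariant μ → μ.map (fun σ : Literature.MathematicalPhysics.KineticTheory.HeatConduction.ChainConfig => fun x : ℤ => ((σ x).1, -(σ x).2)) = μ → ∀ D : Literature.MathematicalPhysics.KineticTheory.HeatConduction.InfiniteChainDynamics (Literature.MathematicalPhysics.KineticTheory.HeatConduction.pinnedChain ω₂ lam β γ), D.PreservesMeasure μ → (∀ t : ℝ, ∀ᵐ σ ∂μ, D.flow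 t (Literature.MathematicalPhysics.KineticTheory.HeatConduction.shift σ) = Literature.MathematicalPhysics.KineticTheory.HeatConduction.shift (D.flow t σ)) → (∀ t : ℝ, D.HasAbsConvergentCorrelation μ t) → Continuous (fun t : ℝ => D.currentCorrelation μ t) → ∀ ρ : MeasureTheory.Measure ℝ, MeasureTheory.IsFiniteMeasure ρ → (∀ t : ℝ, 0 ≤ t → D.currentCorrelation μ t = ∫ w : ℝ, Real.cos (w * t) ∂ρ) → 0 < ρ {0} ∨ ¬ MeasureTheory.Integrable (fun w : ℝ => (w ^ 2)⁻¹) ρ := by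
  intro ω₂ lam β γ hω hl hβ T hT μ hG hS hR D hP hcov hAC hC ρ hfin hrep
  by_contra hcon
  push Not at hcon
  obtain ⟨h0', hint⟩ := hcon
  have h0 : ρ {0} = 0 := le_antisymm h0' bot_le
  obtain ⟨τ, hτ, hlt⟩ := hU ω₂ lam β γ hω hl hβ T hT μ hG hS hR D hP hcov hAC hC _ rfl
    (4 * ∫ w, (w ^ 2)⁻¹ ∂ρ)
  have hEq : (2 * ∫ s in Ioc (0:ℝ) τ, (τ - s) * D.currentCorrelation μ s)
      = 2 * ∫ s in Ioc (0:ℝ) τ, (τ - s) * ∫ w, Real.cos (w * s) ∂ρ := by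
    congr 1
    refine setIntegral_congr_fun measurableSet_Ioc fun s hs => ?_
    rw [hrep s hs.1.le]
  have hle := spectralHeatVariance_le_of_integrable_inv_sq ρ h0 hint τ
  have hlt' : 4 * ∫ w, (w ^ 2)⁻¹ ∂ρ < 2 * ∫ s in Ioc (0:ℝ) τ, (τ - s) * D.currentCorrelation μ s := hlt
  linarith

end Summit.AtomisticToContinuum.FouriersLaw.Theorems.UnboundedHeatVariance.Negative

end
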